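import Summits.NavierStokesRegularity.FluidComputer.RotorKnob
import Summits.NavierStokesRegularity.FluidComputer.GateBudgetZeno
import HarnessLib

/-!
# The seed–rotor scale knob: the NECESSITY columns in knob coordinates (gen 21's laws read on the
# two-scale family `rotorCircuit K M ε ρ`)

Cell `pub-fluidc`, blueprint seat bp1 (gen 24, block 2; successor S17″ of SPEC-INPUT-bp1 §P);
namespace `Summit.NavierStokesRegularity.FluidComputer.RotorKnob`. HONEST FRAMING (verbatim): low
prior, high value-of-information experiment on Tao's machine paradigm; NOT a claim that NS blows up.
Everything concerns five-mode quadratic ODEs on ℝ⁵ — the two-scale family `rotorCircuit K M ε ρ` of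
`RotorKnob.lean` (clock `ε`: a→b, amplifier `ε⁻¹M`: b⇒c, seed `ρ²e^{-M}`: a→c, rotor `ρ⁻²`: c∘(a,d),
drain `K`: d→ã; `ρ = ε` is `delayCircuitWith K M ε`, and `M = K¹⁰`, `ρ = ε` is Tao's circuit (5.5)
of [Tao2016AveragedNS, §5.5]) started EXACTLY at (5.6) `delayInit`; nothing is proved about
Navier–Stokes.

WHAT. `rotorCircuit K M ε ρ` IS the member `σ = ρ²e^{-M}`, `μ = ε⁻¹M`, `R = ρ⁻²` of gen 21's
five-coupling family `GateBudget.fiveGateCircuit ε σ μ R K` (`rotorCircuit_eq_fiveGate`, by `rfl`),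
so the one-sided laws of `GateBudget{,Arming,Zeno}.lean` hold for it; this file writes the three
that constrain the KNOB `σ_knob = ρ²/ε` in knob coordinates, for EVERY exact trajectory from (5.6):
* (`knob_trigger_budget`) the trigger never exceeds what clock and seed pump:
  `c(t) ≤ (ε + ρ²e^{-M})t`;
* (`knob_no_early_output`) THE DELAY IS KNOB-INDEPENDENT: for `M ≥ 1`, `0 < ε`, `0 < ρ`, `ρ² ≤ ε`
  and `0 ≤ t ≤ √2`, `ã(t) ≤ (e/M)·e^{-M(1 - t²/2)}` — the product seed × rotor is pinned at
  `e^{-M}`, so no choice of `ρ` advances the output before `≈ √2` (gen 21's arming law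
  `GateBudget.output_le_arming`);
* (`knob_design_inequality`, `knob_necessary`) THE ZENO LAW IN KNOB COORDINATES: an output
  `ã(T) ≥ θ > 0` at `T ≥ 0` forces `M·K·θ³·ρ⁴ ≤ 4εT(2ε + ρ²e^{-M})`, hence, in the regime `ρ² ≤ ε`
  of every certified theorem, `M·K·θ³·ρ⁴ ≤ 12ε²T`, i.e. `σ_knob² ≤ 12T/(MKθ³)`
  (`knob_necessary_sq`); at the certified output level (`|ã(T) - 1| ≤ 200K⁻¹⁰`, `K ≥ 2`)
  `M·K·ρ⁴ ≤ 96ε²T` (`knob_necessary_of_fired`); Tao's amplifier `M = K¹⁰`: `K¹¹θ³ρ⁴ ≤ 12ε²T`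
  (`taoAmplifier_knob_necessary`).

THE TWO-SIDED PICTURE (remark; the sufficiency half is `RotorKnobPulse.lean`, gen 24 block 1, and
gen 22's `RotorKnob.transition_explicit`). NECESSARY for firing to level `θ` by time `T`:
`σ_knob ≤ √(12T/(MKθ³))` — POLYNOMIAL in `M`, `K`. SUFFICIENT for Theorem 5.3 (clock `ε ≤ K⁻¹⁰⁰`):
`σ_knob ≤ e^{-700·M·log K/K}/K¹⁸⁰⁰`. The gap between the two typed sides is the pulse-duration
effect (the trigger pulse must outlast the `Θ(log K/K)` drain), typed on neither side; the
conjectured true threshold `K^{-Θ(1+M/K)}` is the necessity successor S13″ of SPEC-INPUT-bp1. No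
claim is made here beyond the displayed inequalities. [cite: Tao2016AveragedNS, §5.4, §5.5 Theorem
5.3]. No named facts; 0 sorry.
-/

noncomputable section

namespace Summit.NavierStokesRegularity.FluidComputer.RotorKnob

open Set Real Filter
open _root_.Topology
open Literature.Analysis.FluidPDE.Tao2016AveragedNS
open Literature.Analysis.FluidPDE.Tao2016AveragedNS.Thm53 (init_a init_b init_c init_d init_e)

variable {K M ε ρ : ℝ} {X : ℝ → Fin 5 → ℝ}

/-! ## §N1 The knob family inside the five-coupling family -/

/-- `rotorCircuit K M ε ρ` is the member `σ = ρ²e^{-M}`, `μ = ε⁻¹M`, `R = ρ⁻²` (drain `K`, clock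
`ε`) of gen 21's `GateBudget.fiveGateCircuit ε σ μ R K` — definitionally. [cite: Tao2016AveragedNS,
§5.5 (5.5)] -/
theorem rotorCircuit_eq_fiveGate (K M ε ρ : ℝ) :
    rotorCircuit K M ε ρ =
      GateBudget.fiveGateCircuit ε (ρ ^ 2 * exp (-M)) (ε⁻¹ * M) ((ρ ^ 2)⁻¹) K := rfl

/-- **TRIGGER BUDGET in knob coordinates**: `c(t) ≤ (ε + ρ²e^{-M})·t` for `t ≥ 0` (`ε ≥ 0`) —
whatever the amplifier `M` and the rotor do, the trigger never holds more than clock and seed have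
pumped (gen 21 `GateBudget.trigger_budget`). [cite: Tao2016AveragedNS, §5.5 proof (ob-2)] -/
theorem knob_trigger_budget (hX : ∀ t, HasDerivAt X (rotorCircuit K M ε ρ (X t)) t)
    (h0 : X 0 = delayInit) (hε : 0 ≤ ε) {t : ℝ} (ht : 0 ≤ t) :
    X t 2 ≤ (ε + ρ ^ 2 * exp (-M)) * t := by
  rw [rotorCircuit_eq_fiveGate] at hX
  have h := GateBudget.trigger_budget hX h0 hε (by positivity) ht
  exact ((le_abs_self _).trans (abs_le_sqrt (by nlinarith [sq_nonneg (X t 1)]))).trans h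

/-! ## §N2 The delay is knob-independent (arming law) -/

/-- **THE DELAY CANNOT BE TUNED AWAY BY THE KNOB.** Along every exact trajectory of
`rotorCircuit K M ε ρ` from (5.6) with `M ≥ 1`, `0 < ε`, `0 < ρ`, `ρ² ≤ ε` (the regime of every
certified theorem) and ANY real drain `K`, for `0 ≤ t` with `t² ≤ 2`:
`ã(t) ≤ (e/M)·exp(-M(1 - t²/2))`. Here `Rσ = ρ⁻²·ρ²e^{-M} = e^{-M}` is PINNED (independent of `ρ`),
`κ = μ(ε+σ) = M(1 + (ρ²/ε)e^{-M}) ≥ M` and `κt²/2 ≤ Mt²/2 + 1`; so at `t = √(2(1-η))` the output is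
`≤ (e/M)e^{-ηM}` for every knob value: the `√2` delay of Theorem 5.3 is a property of the seed ×
rotor product, not of the knob (gen 21 `GateBudget.output_le_arming`, `taoFamily_no_early_output`).
[cite: Tao2016AveragedNS, §5.5 Thm 5.3 (j), caricature (i)] -/
theorem knob_no_early_output (hX : ∀ t, HasDerivAt X (rotorCircuit K M ε ρ (X t)) t)
    (h0 : X 0 = delayInit) (hM : 1 ≤ M) (hε : 0 < ε) (hρ : 0 < ρ) (hρε : ρ ^ 2 ≤ ε) {t : ℝ}
    (ht : 0 ≤ t) (ht2 : t ^ 2 ≤ 2) :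
    X t 4 ≤ exp 1 / M * exp (-(M * (1 - t ^ 2 / 2))) := by
  rw [rotorCircuit_eq_fiveGate] at hX
  have hM0 : 0 < M := by linarith
  have hσ : 0 ≤ ρ ^ 2 * exp (-M) := by positivity
  have hμ : 0 ≤ ε⁻¹ * M := by positivity
  have hR : 0 ≤ (ρ ^ 2)⁻¹ := by positivity
  set κ := ε⁻¹ * M * (ε + ρ ^ 2 * exp (-M)) with hκdef
  -- the knob `s = ρ²/ε ∈ (0, 1]`
  set s := ρ ^ 2 / ε with hsdef
  have hs0 : 0 ≤ s := by positivity
  have hs1 : s ≤ 1 := by rw [hsdef, div_le_one hε]; exact hρε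
  have hκM : κ = M * (1 + s * exp (-M)) := by
    rw [hκdef, hsdef]; field_simp
  have hκ : 0 < κ := by rw [hκM]; positivity
  have h := GateBudget.output_le_arming hX h0 hε.le hσ hμ hR hκ ht
  have he : X t 4 ≤ sqrt (X t 3 ^ 2 + X t 4 ^ 2) :=
    (le_abs_self _).trans (abs_le_sqrt (by nlinarith [sq_nonneg (X t 3)]))
  -- the prefactor `Rσ/κ = e^{-M}/(M(1+s e^{-M})) ≤ e^{-M}/M`
  have hpre : (ρ ^ 2)⁻¹ * (ρ ^ 2 * exp (-M)) / κ ≤ exp (-M) / M := by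
    have : (ρ ^ 2)⁻¹ * (ρ ^ 2 * exp (-M)) = exp (-M) := by field_simp
    rw [this, hκM]
    apply div_le_div_of_nonneg_left (exp_pos _).le hM0
    have : 0 ≤ M * (s * exp (-M)) := by positivity
    linarith
  -- the exponent `κt²/2 ≤ Mt²/2 + 1`
  have hexpo : κ * t ^ 2 / 2 ≤ M * t ^ 2 / 2 + 1 := by
    rw [hκM]
    have h1 : exp (-M) * M ≤ 1 := by
      have := add_one_le_exp M
      have hEM : exp (-M) * exp M = 1 := by rw [← exp_add, neg_add_cancel, exp_zero]
      nlinarith [exp_pos (-M), exp_pos M]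
    have h2 : M * (s * exp (-M)) * t ^ 2 / 2 ≤ exp (-M) * M := by
      have : s * t ^ 2 / 2 ≤ 1 := by nlinarith
      have h3 : M * (s * exp (-M)) * t ^ 2 / 2 = (exp (-M) * M) * (s * t ^ 2 / 2) := by ring
      rw [h3]
      exact mul_le_of_le_one_right (by positivity) this
    nlinarith
  have hmono : exp (κ * t ^ 2 / 2) - 1 ≤ exp (M * t ^ 2 / 2 + 1) := by
    have := exp_le_exp.2 hexpo; linarith [exp_pos (κ * t ^ 2 / 2)]
  have hnn : 0 ≤ exp (κ * t ^ 2 / 2) - 1 := by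
    have : 1 ≤ exp (κ * t ^ 2 / 2) := one_le_exp_iff.2 (by positivity)
    linarith
  calc X t 4 ≤ (ρ ^ 2)⁻¹ * (ρ ^ 2 * exp (-M)) / κ * (exp (κ * t ^ 2 / 2) - 1) := he.trans h
    _ ≤ exp (-M) / M * exp (M * t ^ 2 / 2 + 1) := mul_le_mul hpre hmono hnn (by positivity)
    _ = exp 1 / M * exp (-(M * (1 - t ^ 2 / 2))) := by
        rw [div_mul_eq_mul_div, div_mul_eq_mul_div, ← exp_add, ← exp_add]
        congr 1; ring_nf

/-- **Before `√2` the output of EVERY knob member is at most `e/M`** (`M ≥ 1`, `0 < ρ² ≤ ε`, any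
drain). [cite: Tao2016AveragedNS, §5.5 Thm 5.3 (j)] -/
theorem knob_output_before_sqrt_two (hX : ∀ t, HasDerivAt X (rotorCircuit K M ε ρ (X t)) t)
    (h0 : X 0 = delayInit) (hM : 1 ≤ M) (hε : 0 < ε) (hρ : 0 < ρ) (hρε : ρ ^ 2 ≤ ε) {t : ℝ}
    (ht : 0 ≤ t) (ht2 : t ^ 2 ≤ 2) : X t 4 ≤ exp 1 / M := by
  have h := knob_no_early_output hX h0 hM hε hρ hρε ht ht2
  have hM0 : 0 < M := by linarith
  have h1 : exp (-(M * (1 - t ^ 2 / 2))) ≤ 1 := by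
    rw [exp_le_one_iff]; nlinarith
  calc X t 4 ≤ exp 1 / M * exp (-(M * (1 - t ^ 2 / 2))) := h
    _ ≤ exp 1 / M * 1 := mul_le_mul_of_nonneg_left h1 (by positivity)
    _ = exp 1 / M := mul_one _

/-! ## §N3 The Zeno law in knob coordinates (necessity of a small knob) -/

/-- **THE DESIGN INEQUALITY in knob coordinates.** An output `ã(T) ≥ θ > 0` at `T ≥ 0` along an
exact trajectory of `rotorCircuit K M ε ρ` from (5.6) (`0 < K, M, ε, ρ`) forces
`M·K·θ³·ρ⁴ ≤ 4εT·(2ε + ρ²e^{-M})` — gen 21's `GateBudget.design_inequality` `Kθ³μ ≤ 4R²(2ε+σ)T` with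
`μ = ε⁻¹M`, `R = ρ⁻²`, `σ = ρ²e^{-M}`, multiplied by `ερ⁴`. [cite: Tao2016AveragedNS, §5.5 Theorem
5.3] -/
theorem knob_design_inequality (hX : ∀ t, HasDerivAt X (rotorCircuit K M ε ρ (X t)) t)
    (h0 : X 0 = delayInit) (hK : 0 < K) (hM : 0 < M) (hε : 0 < ε) (hρ : 0 < ρ) {T θ : ℝ}
    (hT : 0 ≤ T) (hθ : 0 < θ) (hθe : θ ≤ X T 4) :
    M * K * θ ^ 3 * ρ ^ 4 ≤ 4 * ε * T * (2 * ε + ρ ^ 2 * exp (-M)) := by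
  rw [rotorCircuit_eq_fiveGate] at hX
  have hσ : 0 ≤ ρ ^ 2 * exp (-M) := by positivity
  have h := GateBudget.design_inequality hX h0 hε.le hσ (by positivity) (by positivity) hK hT hθ hθe
  -- h : K * θ ^ 3 * (ε⁻¹ * M) ≤ 4 * ((ρ ^ 2)⁻¹) ^ 2 * ((2 * ε + ρ ^ 2 * exp (-M)) * T)
  have hρ2 : 0 < ρ ^ 2 := by positivity
  have e1 : M * K * θ ^ 3 * ρ ^ 4 = (K * θ ^ 3 * (ε⁻¹ * M)) * (ε * ρ ^ 4) := by
    field_simp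
  have e2 : 4 * ε * T * (2 * ε + ρ ^ 2 * exp (-M)) =
      (4 * ((ρ ^ 2)⁻¹) ^ 2 * ((2 * ε + ρ ^ 2 * exp (-M)) * T)) * (ε * ρ ^ 4) := by
    field_simp
  rw [e1, e2]
  exact mul_le_mul_of_nonneg_right h (by positivity)

/-- **THE KNOB IS NECESSARILY SMALL (polynomially).** In the regime `ρ² ≤ ε` of every certified
theorem: an output `ã(T) ≥ θ > 0` at `T ≥ 0` forces `M·K·θ³·ρ⁴ ≤ 12ε²T` (`2ε + ρ²e^{-M} ≤ 3ε`).
[cite: Tao2016AveragedNS, §5.4, §5.5] -/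
theorem knob_necessary (hX : ∀ t, HasDerivAt X (rotorCircuit K M ε ρ (X t)) t)
    (h0 : X 0 = delayInit) (hK : 0 < K) (hM : 0 < M) (hε : 0 < ε) (hρ : 0 < ρ) (hρε : ρ ^ 2 ≤ ε)
    {T θ : ℝ} (hT : 0 ≤ T) (hθ : 0 < θ) (hθe : θ ≤ X T 4) :
    M * K * θ ^ 3 * ρ ^ 4 ≤ 12 * ε ^ 2 * T := by
  have h := knob_design_inequality hX h0 hK hM hε hρ hT hθ hθe
  have hexp : exp (-M) ≤ 1 := by rw [exp_le_one_iff]; linarith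
  have h3 : 2 * ε + ρ ^ 2 * exp (-M) ≤ 3 * ε := by
    nlinarith [mul_le_mul hρε hexp (exp_pos _).le hε.le]
  calc M * K * θ ^ 3 * ρ ^ 4 ≤ 4 * ε * T * (2 * ε + ρ ^ 2 * exp (-M)) := h
    _ ≤ 4 * ε * T * (3 * ε) := mul_le_mul_of_nonneg_left h3 (by positivity)
    _ = 12 * ε ^ 2 * T := by ring

/-- The same in the knob variable `σ_knob = ρ²/ε`: `(ρ²/ε)² ≤ 12T/(MKθ³)` — firing to level `θ` by
time `T` needs the knob below `√(12T/(MKθ³))`, a POLYNOMIAL bound (compare the certified sufficient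
condition `ρ²/ε ≤ e^{-700·M·log K/K}/K¹⁸⁰⁰` of `RotorKnobPulse.lean`). [cite: Tao2016AveragedNS,
§5.5] -/
theorem knob_necessary_sq (hX : ∀ t, HasDerivAt X (rotorCircuit K M ε ρ (X t)) t)
    (h0 : X 0 = delayInit) (hK : 0 < K) (hM : 0 < M) (hε : 0 < ε) (hρ : 0 < ρ) (hρε : ρ ^ 2 ≤ ε)
    {T θ : ℝ} (hT : 0 ≤ T) (hθ : 0 < θ) (hθe : θ ≤ X T 4) :
    (ρ ^ 2 / ε) ^ 2 ≤ 12 * T / (M * K * θ ^ 3) := by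
  have h := knob_necessary hX h0 hK hM hε hρ hρε hT hθ hθe
  rw [div_pow, div_le_div_iff₀ (by positivity) (by positivity)]
  calc (ρ ^ 2) ^ 2 * (M * K * θ ^ 3) = M * K * θ ^ 3 * ρ ^ 4 := by ring
    _ ≤ 12 * ε ^ 2 * T := h
    _ = 12 * T * ε ^ 2 := by ring

/-- **At the certified output level.** If at some time `T ≥ 0` the output is within the fired box of
Theorem 5.3, `|ã(T) - 1| ≤ 200K⁻¹⁰` with `K ≥ 2` (so `ã(T) ≥ 1/2`), then `M·K·ρ⁴ ≤ 96ε²T` (`ρ² ≤ ε`;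
`θ = 1/2`). Every member certified by `RotorKnob.transition_explicit` /
`RotorKnobPulse.transition_pulseThreshold` is fired from a time `≤ 2`, so satisfies
`M·K·ρ⁴ ≤ 192ε²`: necessary `(ρ²/ε)² ≤ 192/(MK)` against sufficient
`ρ²/ε ≤ e^{-700·M·log K/K}/K¹⁸⁰⁰`. [cite: Tao2016AveragedNS, §5.5 Theorem 5.3] -/
theorem knob_necessary_of_fired (hX : ∀ t, HasDerivAt X (rotorCircuit K M ε ρ (X t)) t)
    (h0 : X 0 = delayInit) (hK : 2 ≤ K) (hM : 0 < M) (hε : 0 < ε) (hρ : 0 < ρ) (hρε : ρ ^ 2 ≤ ε)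
    {T : ℝ} (hT : 0 ≤ T) (hfired : |X T 4 - 1| ≤ 200 / K ^ 10) :
    M * K * ρ ^ 4 ≤ 96 * ε ^ 2 * T := by
  have hK0 : 0 < K := by linarith
  have hK10 : (2:ℝ) ^ 10 ≤ K ^ 10 := pow_le_pow_left₀ (by norm_num) hK 10
  have h200 : 200 / K ^ 10 ≤ 1 / 2 := by
    rw [div_le_iff₀ (by positivity)]
    nlinarith
  have hθe : (1:ℝ) / 2 ≤ X T 4 := by
    have := (abs_le.1 (hfired.trans h200)).1
    linarith
  have h := knob_necessary hX h0 hK0 hM hε hρ hρε hT (by norm_num : (0:ℝ) < 1 / 2) hθe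
  nlinarith

/-- **Tao's amplifier `M = K¹⁰`.** An output `ã(T) ≥ θ > 0` at `T ≥ 0` along
`rotorCircuit K K¹⁰ ε ρ` (`0 < ρ² ≤ ε`) forces `K¹¹·θ³·ρ⁴ ≤ 12ε²T`: with a polynomial clock
`ε = K^{-p}` the knob family can fire only if `ρ⁴ ≤ 12Tθ⁻³K^{-2p-11}`. [cite: Tao2016AveragedNS,
§5.4, §5.5 (5.5)] -/
theorem taoAmplifier_knob_necessary {K ε ρ : ℝ} {X : ℝ → Fin 5 → ℝ}
    (hX : ∀ t, HasDerivAt X (rotorCircuit K (K ^ 10) ε ρ (X t)) t) (h0 : X 0 = delayInit)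
    (hK : 0 < K) (hε : 0 < ε) (hρ : 0 < ρ) (hρε : ρ ^ 2 ≤ ε) {T θ : ℝ} (hT : 0 ≤ T) (hθ : 0 < θ)
    (hθe : θ ≤ X T 4) : K ^ 11 * θ ^ 3 * ρ ^ 4 ≤ 12 * ε ^ 2 * T := by
  have h := knob_necessary hX h0 hK (by positivity) hε hρ hρε hT hθ hθe
  calc K ^ 11 * θ ^ 3 * ρ ^ 4 = K ^ 10 * K * θ ^ 3 * ρ ^ 4 := by ring
    _ ≤ 12 * ε ^ 2 * T := h

end Summit.NavierStokesRegularity.FluidComputer.RotorKnob
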